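import Summits.ValiantsHypothesis.ValiantsHypothesis.Theorems.BarrierLeverPartitionMinorsChowIntegerCertificates

/-!
# Route BarrierLever — item `ChowHitsPartitionMinorsR` (stmt-ValiantsHypothesis-21882):
# the x-STAR design — its partition matrix in closed form, and the arrow «XS-matrix nonsingular ⇒ hit»

Helper file (`--supports stmt-ValiantsHypothesis-21882`; cell valiant-natproofs, rung V4, 𝒟-side
support item of route BarrierLever; prover seat val-np-p5 gen 29). Definition-free, route-independent
(imports only `…ChowIntegerCertificates`). Closes NO item.

THE x-STAR DESIGN (seat memo MEMO-21882-valnp5-g29.md §9–§10): one affine form per `x`-variable,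
`ℓ_j = 1 + x_j + Σ_c β_{j c} y_c` (`j < h`). Since `x_j` occurs only in `ℓ_j` (with coefficient `1`),
the `x^S y^W`-coefficient of `∏_{j ∈ J} ℓ_j` is the `y^W`-coefficient of the product of the
COMPLEMENTARY `y`-parts `∏_{j ∈ J ∖ S} (1 + Σ_c β_{j c} y_c)` (`coeff_partitionExpo_prod_xstar`, any
layout, any commutative field of coefficients). Hence (`chowHits_of_xstarMatrix`): **whenever the
XS-MATRIX `[coeff_{y^{w j}} ∏_{a ∉ u i} (1 + Σ_c β_{a c} y_c)]_{i,j}` of a layout `(u, w)` is nonsingular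
for some `β`, the layout is hit by `h` affine forms.** CONJECTURE XS of the memo (census-clean for all
lower tail-dominated pairs, h ≤ 5): such a `β` exists for every pair of lower-set families `R, C` with
`|R| = |C|` and `#{S ∈ R : |S| ≥ d} ≤ #{W ∈ C : |W| ≥ d}` for all `d` (the condition is necessary).

WHAT THIS IS NOT: item 21882 is NOT proved; nothing on crux stmt-ValiantsHypothesis-14610 or on
`VP` versus `VNP`.
-/

set_option linter.dupNamespace false

namespace Summit.ValiantsHypothesis.ValiantsHypothesis.Theorems.BarrierLever.ChowXStar

open Finset MvPolynomial
open Summit.ValiantsHypothesis.ValiantsHypothesis.Theorems.BarrierLever.ChowFactor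
  (coeff_partitionExpo_one coeff_partitionExpo_mul_affine)

noncomputable section

variable {h r : ℕ} {K : Type*} [Field K]

/-! ## 1. Affine forms in the `(c₀, α, b)` format -/

/-- A form `C c₀ + Σ_a C α_a · x_a + Σ_c C b_c · y_c` has total degree `≤ 1`. -/
theorem totalDegree_fullAffine_le (c₀ : K) (α b : Fin h → K) :
    (C c₀ + ∑ a, C (α a) * X (Fin.castAdd h a) + ∑ c, C (b c) * X (Fin.natAdd h c) :
      MvPolynomial (Fin (h + h)) K).totalDegree ≤ 1 := by
  have hterm : ∀ (s : K) (v : Fin (h + h)),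
      (C s * X v : MvPolynomial (Fin (h + h)) K).totalDegree ≤ 1 := fun s v => by
    refine (totalDegree_mul _ _).trans ?_
    rw [totalDegree_C, zero_add]
    exact (totalDegree_X _).le
  refine (totalDegree_add _ _).trans (max_le ((totalDegree_add _ _).trans (max_le ?_ ?_)) ?_)
  · rw [totalDegree_C]; exact zero_le_one
  · exact totalDegree_finsetSum_le fun a _ => hterm _ _
  · exact totalDegree_finsetSum_le fun c _ => hterm _ _

/-! ## 2. The partition coefficients of the x-star product -/

/-- **Closed form of the x-star design's partition coefficients.** For `ℓ_j = 1 + x_j + y_{β_j}`: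
`coeff_{x^S y^W} ∏_{j∈J} ℓ_j = [S ⊆ J] · coeff_{y^W} ∏_{j ∈ J∖S} (1 + y_{β_j})`. -/
theorem coeff_partitionExpo_prod_xstar (β : Fin h → Fin h → K) (J S W : Finset (Fin h)) :
    coeff (∑ a ∈ S, Finsupp.single (Fin.castAdd h a) 1 +
          ∑ c ∈ W, Finsupp.single (Fin.natAdd h c) 1) (∏ j ∈ J, (C (1 : K) + ∑ a, C (if a = j then (1 : K) else 0) * X (Fin.castAdd h a) +
            ∑ c, C (β j c) * X (Fin.natAdd h c))) =
      if S ⊆ J then coeff (∑ a ∈ (∅ : Finset (Fin h)), Finsupp.single (Fin.castAdd h a) 1 +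
          ∑ c ∈ W, Finsupp.single (Fin.natAdd h c) 1) (∏ j ∈ J \ S, (C (1 : K) + ∑ a, C (0 : K) * X (Fin.castAdd h a) +
            ∑ c, C (β j c) * X (Fin.natAdd h c))) else 0 := by
  classical
  induction J using Finset.induction_on generalizing S W with
  | empty =>
    rw [Finset.prod_empty, coeff_partitionExpo_one K]
    by_cases hS : S = ∅
    · rw [hS, if_pos (Finset.empty_subset _), Finset.sdiff_self, Finset.prod_empty,
        coeff_partitionExpo_one K]
    · rw [if_neg (fun hh => hS hh.1), if_neg (fun hh => hS (Finset.subset_empty.mp hh))]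
  | insert a J haJ ih =>
    rw [Finset.prod_insert haJ, mul_comm, coeff_partitionExpo_mul_affine, one_mul, ih S W]
    -- the `x`-sum: only `a' = a` contributes
    have hx : ∑ a' ∈ S, (if a' = a then (1 : K) else 0) *
        coeff (∑ a ∈ S.erase a', Finsupp.single (Fin.castAdd h a) 1 +
          ∑ c ∈ W, Finsupp.single (Fin.natAdd h c) 1) (∏ j ∈ J, (C (1 : K) + ∑ a, C (if a = j then (1 : K) else 0) * X (Fin.castAdd h a) +
            ∑ c, C (β j c) * X (Fin.natAdd h c))) =
        if a ∈ S then coeff (∑ a ∈ S.erase a, Finsupp.single (Fin.castAdd h a) 1 +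
          ∑ c ∈ W, Finsupp.single (Fin.natAdd h c) 1) (∏ j ∈ J, (C (1 : K) + ∑ a, C (if a = j then (1 : K) else 0) * X (Fin.castAdd h a) +
            ∑ c, C (β j c) * X (Fin.natAdd h c))) else 0 := by
      simp only [ite_mul, one_mul, zero_mul]
      rw [← Finset.sum_filter, Finset.filter_eq' S a]
      by_cases ha : a ∈ S
      · rw [if_pos ha, if_pos ha, Finset.sum_singleton]
      · rw [if_neg ha, if_neg ha, Finset.sum_empty]
    rw [hx]
    by_cases ha : a ∈ S
    · -- `a ∈ S`: the form `ℓ_a` must contribute its `x_a`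
      have hSJ : ¬ S ⊆ J := fun hh => haJ (hh ha)
      have hiff : S ⊆ insert a J ↔ S.erase a ⊆ J := Finset.subset_insert_iff
      have hsd : insert a J \ S = J \ S.erase a := by
        ext x
        rw [Finset.mem_sdiff, Finset.mem_sdiff, Finset.mem_insert, Finset.mem_erase]
        constructor
        · rintro ⟨hx | hx, hxS⟩
          · exact absurd (hx ▸ ha) hxS
          · exact ⟨hx, fun hh => hxS hh.2⟩
        · rintro ⟨hxJ, hxS⟩
          exact ⟨Or.inr hxJ, fun hh => hxS ⟨fun e => haJ (e ▸ hxJ), hh⟩⟩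
      rw [if_neg hSJ, zero_add, if_pos ha, ih (S.erase a) W]
      have hzero : ∑ c ∈ W, β a c * coeff (∑ a ∈ S, Finsupp.single (Fin.castAdd h a) 1 +
          ∑ c ∈ W.erase c, Finsupp.single (Fin.natAdd h c) 1) (∏ j ∈ J, (C (1 : K) + ∑ a, C (if a = j then (1 : K) else 0) * X (Fin.castAdd h a) +
            ∑ c, C (β j c) * X (Fin.natAdd h c))) = 0 := by
        refine Finset.sum_eq_zero fun c _ => ?_
        rw [ih S (W.erase c), if_neg hSJ, mul_zero]
      rw [hzero, add_zero]
      by_cases hSa : S.erase a ⊆ J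
      · rw [if_pos hSa, if_pos (hiff.mpr hSa), hsd]
      · rw [if_neg hSa, if_neg (fun hh => hSa (hiff.mp hh))]
    · -- `a ∉ S`: the form `ℓ_a` contributes its `y`-part
      rw [if_neg ha, add_zero]
      have hiff : S ⊆ insert a J ↔ S ⊆ J := by
        rw [Finset.subset_insert_iff, Finset.erase_eq_of_notMem ha]
      by_cases hSJ : S ⊆ J
      · rw [if_pos hSJ, if_pos (hiff.mpr hSJ)]
        have hsum : ∑ c ∈ W, β a c * coeff (∑ a ∈ S, Finsupp.single (Fin.castAdd h a) 1 +
          ∑ c ∈ W.erase c, Finsupp.single (Fin.natAdd h c) 1) (∏ j ∈ J, (C (1 : K) + ∑ a, C (if a = j then (1 : K) else 0) * X (Fin.castAdd h a) +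
            ∑ c, C (β j c) * X (Fin.natAdd h c))) =
            ∑ c ∈ W, β a c * coeff (∑ a ∈ (∅ : Finset (Fin h)), Finsupp.single (Fin.castAdd h a) 1 +
          ∑ c ∈ W.erase c, Finsupp.single (Fin.natAdd h c) 1) (∏ j ∈ J \ S, (C (1 : K) + ∑ a, C (0 : K) * X (Fin.castAdd h a) +
            ∑ c, C (β j c) * X (Fin.natAdd h c))) :=
          Finset.sum_congr rfl fun c _ => by rw [ih S (W.erase c), if_pos hSJ]
        rw [hsum, Finset.insert_sdiff_of_notMem J ha, Finset.prod_insert (fun hh => haJ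
          (Finset.mem_sdiff.mp hh).1), mul_comm, coeff_partitionExpo_mul_affine, one_mul]
        simp only [zero_mul, Finset.sum_const_zero, add_zero]
      · rw [if_neg hSJ, if_neg (fun hh => hSJ (hiff.mp hh))]
        refine (zero_add _).trans (Finset.sum_eq_zero fun c _ => ?_)
        rw [ih S (W.erase c), if_neg hSJ, mul_zero]

/-! ## 3. The arrow: a nonsingular XS-matrix gives a hit by `h` affine forms -/

/-- **x-star arrow.** If for some `β` the XS-matrix
`[coeff_{y^{w j}} ∏_{a ∉ u i} (1 + Σ_c β_{a c} y_c)]_{i,j}` of the layout `(u, w)` is nonsingular, then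
`(u, w)` is hit by the `h` affine forms `1 + x_a + Σ_c β_{a c} y_c`. -/
theorem chowHits_of_xstarMatrix (u w : Fin r → Finset (Fin h)) (β : Fin h → Fin h → K)
    (hdet : (Matrix.of fun i j : Fin r => coeff (∑ a ∈ (∅ : Finset (Fin h)), Finsupp.single (Fin.castAdd h a) 1 +
          ∑ c ∈ w j, Finsupp.single (Fin.natAdd h c) 1)
      (∏ a ∈ Finset.univ \ u i, (C (1 : K) + ∑ a, C (0 : K) * X (Fin.castAdd h a) +
            ∑ c, C (β a c) * X (Fin.natAdd h c)))).det ≠ 0) :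
    ∃ ℓ : Fin h → MvPolynomial (Fin (h + h)) K, (∀ k, (ℓ k).totalDegree ≤ 1) ∧
      (Matrix.of fun i j : Fin r => MvPolynomial.coeff (∑ a ∈ u i, Finsupp.single (Fin.castAdd h a) 1 +
          ∑ c ∈ w j, Finsupp.single (Fin.natAdd h c) 1) (∏ k, ℓ k)).det ≠ 0 := by
  classical
  refine ⟨fun k => (C (1 : K) + ∑ a, C (if a = k then (1 : K) else 0) * X (Fin.castAdd h a) +
            ∑ c, C (β k c) * X (Fin.natAdd h c)), fun k => totalDegree_fullAffine_le _ _ _, ?_⟩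
  have hmat : (Matrix.of fun i j : Fin r => MvPolynomial.coeff (∑ a ∈ u i, Finsupp.single (Fin.castAdd h a) 1 +
          ∑ c ∈ w j, Finsupp.single (Fin.natAdd h c) 1) (∏ k, (C (1 : K) + ∑ a, C (if a = k then (1 : K) else 0) * X (Fin.castAdd h a) +
            ∑ c, C (β k c) * X (Fin.natAdd h c)))) =
      Matrix.of fun i j : Fin r => coeff (∑ a ∈ (∅ : Finset (Fin h)), Finsupp.single (Fin.castAdd h a) 1 +
          ∑ c ∈ w j, Finsupp.single (Fin.natAdd h c) 1) (∏ a ∈ Finset.univ \ u i, (C (1 : K) + ∑ a, C (0 : K) * X (Fin.castAdd h a) +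
            ∑ c, C (β a c) * X (Fin.natAdd h c))) := by
    ext i j
    rw [Matrix.of_apply, Matrix.of_apply, coeff_partitionExpo_prod_xstar β Finset.univ (u i) (w j),
      if_pos (Finset.subset_univ _)]
  rw [hmat]
  exact hdet

end

end Summit.ValiantsHypothesis.ValiantsHypothesis.Theorems.BarrierLever.ChowXStar
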